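import Summits.ResolutionOfSingularities.ResolutionOfSingularities.Theorems.WeightedInvariantIota3TauEssSmoothAscent
import HarnessLib

/-!
# (c11τ)≤3 ⟸ ITS DESCENT HALF ALONE (hence the gap hc10 of the P3 rung ⟸ «tie positions descend» ∧ `hσ`)
# (door `HypersurfaceCentreConstruction`, stmt-ResolutionOfSingularities-19897; registered stub `stub_keyRungGrHomLE_three`)

Topic: `Summits/ResolutionOfSingularities/ResolutionOfSingularities/Theorems`. Helper for the door item `HypersurfaceCentreConstruction`
(stmt-ResolutionOfSingularities-19897, route `WeightedInvariant`), line `local-engine`, def-free.  Audit glue over …Iota3TauEssSmoothAscent (the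
ASCENT half of (c11τ)≤3, `Iota3.iotaTau_le_iotaTau_map_of_essSmooth`) and …IotaFlatTTorusFactorOfTauEssSmooth (hc10 ⟸ (c11τ)≤3 ∧ `hσ`):

* `Iota3.iotaTau_essSmooth_eq_of_descent` — (c11τ)≤3 «`τ(S', φ f) = τ(S, f)`, `dim S' ≤ 3`» follows from the DESCENT OF TIE POSITIONS alone:
  (desc-τ) `∀ φ : T → T'` local formally smooth essentially of finite type between regular local rings, `dim T' ≤ 3`:
  `IsTiePosition T' (φ g) → IsTiePosition T g` (at `dim T ≤ 2` this says «no tie position over a base of dimension `≤ 2`»);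
* hence the gap hc10 `IotaTorusFactorMonotoneLE 3 p iotaFlatT` ⟸ (desc-τ) ∧ `hσ`, by `iotaFlatT_torusFactorMonotoneLE_of_tauEssSmooth` applied to
  `fun T T' _ _ _ _ _ _ _ _ g hd => iotaTau_essSmooth_eq_of_descent hD T T' g hd` (one line; not restated here — the gate's dedup treats it as the
  landed theorem).

[OURS · L1 W4.3 · audit glue]  Replaces the role of NO printed item; NOT a statement of the manuscript under review [claim: Hironaka2017,
status: under-review]; candidates stay candidates; AI work, weaker than expert review.  No definition; no axiom; (desc-τ) and `hσ` are hypotheses.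
-/

noncomputable section

set_option linter.dupNamespace false -- mandated namespace `Summit.<Summit>.<Problem>` of this single-conjunct summit

open IsLocalRing Literature.AlgebraicGeometry.Resolution
open Summit.ResolutionOfSingularities.ResolutionOfSingularities.Theorems

namespace Summit.ResolutionOfSingularities.ResolutionOfSingularities.Cruxes.HypersurfaceCentreConstruction.LocalEngine

namespace Iota3

section Descent

variable
  (hD : ∀ (T T' : Type) [CommRing T] [IsRegularLocalRing T] [CommRing T'] [IsRegularLocalRing T'] [Algebra T T']
    [IsLocalHom (algebraMap T T')] [Algebra.FormallySmooth T T'] [Algebra.EssFiniteType T T'] (g : T),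
    ringKrullDim T' ≤ 3 → IsTiePosition T' (algebraMap T T' g) → IsTiePosition T g)
include hD

/-- **(c11τ)≤3 FROM THE DESCENT OF TIE POSITIONS**: along a local, formally smooth, essentially-of-finite-type `φ : S → S'` of regular local
rings with `dim S' ≤ 3`, `τ(S', φ f) = τ(S, f)` — `≥` is the landed ascent `iotaTau_le_iotaTau_map_of_essSmooth`, `≤` is (desc-τ) (at
`dim ≤ 3` the letter `τ` is the raw tie bit). [OURS · (c11τ)≤3 ⟸ (desc-τ)] -/
theorem iotaTau_essSmooth_eq_of_descent (S S' : Type) [CommRing S] [IsRegularLocalRing S] [CommRing S'] [IsRegularLocalRing S']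
    [Algebra S S'] [IsLocalHom (algebraMap S S')] [Algebra.FormallySmooth S S'] [Algebra.EssFiniteType S S'] (f : S)
    (hdimS' : ringKrullDim S' ≤ 3) : iotaTau S' (algebraMap S S' f) = iotaTau S f := by
  refine le_antisymm ?_ (iotaTau_le_iotaTau_map_of_essSmooth S S' hdimS' f)
  rcases iotaTau_eq_zero_or_eq_one S' (algebraMap S S' f) with h0 | h1
  · rw [h0]; exact zero_le
  · have htie' : IsTiePosition S' (algebraMap S S' f) := (iotaTau_eq_one_iff_isTiePosition hdimS' _).mp h1
    rw [h1, iotaTau_of_isTiePosition (hD S S' f hdimS' htie')]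

end Descent

end Iota3

end Summit.ResolutionOfSingularities.ResolutionOfSingularities.Cruxes.HypersurfaceCentreConstruction.LocalEngine

end
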